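import Summits.Ventures.PackingBounds.ThreePointCert.CheckIdKSM

/-!
# Multi-point Kronecker check of the identity `(ii')` — meaning of the programs and soundness

Framing: lottery ticket; floor = certified bounds/negative ranges. Venture `PackingBounds`
(cell `pub-packcert`), three-point SDP family — kernel-checking infrastructure (lp gen 12).
Programs in `CheckIdKSM`; here: the accumulator laws of the grouped evaluators (`ev3_eq`,
`evF_spec`, `evFs_spec`), the value lemmas (`ev_sub`, `evF_sub`), the point lemma
`evalZ_qII_of_idIIAtF` (a passing flat value check at `τ` gives `qII = 0` at `(2^w, 2^{wD}, τ)`),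
`idIIStatic_of` (the static check from per-polynomial facts) and the soundness theorem
`idCheckII_of_pointsF : … → idCheckII w D c P ρ = true` (through
`CheckKSM.eval_eq_zero_of_kronecker_points` and `CheckIdKS.valII_eq`). No statement about
certificates changes; `card_le_of_cert3KS` consumes `idCheckII … = true` as before.
-/

noncomputable section

namespace Summit.Ventures.PackingBounds.ThreePointCert

open Literature.Geometry.DiscreteGeometry Literature.Geometry.DiscreteGeometry.PolyCert
open Literature.Geometry.DiscreteGeometry.PolyCert.SPoly

/-! ### Meaning of the programs -/

/-- `zpos − zneg` is the coefficient. -/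
theorem zpos_sub_zneg (z : ℤ) : ((zpos z : ℕ) : ℤ) - (zneg z : ℕ) = z := by
  cases z with
  | ofNat n => simp [zpos, zneg]
  | negSucc n => simp only [zpos, zneg, Int.negSucc_eq]; push_cast; ring

/-- One sign part of the value: `Σ part(coeff) · x_a^a x_b^b x_c^c`. -/
def partSum (part : ℤ → ℕ) (xa xb xc : ℕ) (p : SPoly) : ℕ :=
  (p.map fun mc : Mono × ℤ => part mc.2 * (xa ^ mc.1.a * xb ^ mc.1.b * xc ^ mc.1.c)).sum

/-- **Accumulator law of `ev3`**: the state carries `a + x_a^ka·(b + x_b^kb·c)`. -/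
theorem ev3_eq (part : ℤ → ℕ) (xa xb xc : ℕ) : ∀ (p : SPoly) (ka kb c b a : ℕ),
    ev3 part xa xb xc p ka kb c b a = a + xa ^ ka * (b + xb ^ kb * c) + partSum part xa xb xc p
  | [], ka, kb, c, b, a => by
    show Nat.add a (Nat.mul (Nat.add b (Nat.mul c (Nat.pow xb kb))) (Nat.pow xa ka)) = _
    simp only [Nat.add_eq, Nat.mul_eq, Nat.pow_eq, partSum, List.map_nil, List.sum_nil]; ring
  | (m, z) :: p, ka, kb, c, b, a => by
    have hs : partSum part xa xb xc ((m, z) :: p) =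
        part z * (xa ^ m.a * xb ^ m.b * xc ^ m.c) + partSum part xa xb xc p := by
      simp [partSum]
    rw [hs]
    show Bool.rec (motive := fun _ => ℕ)
        (ev3 part xa xb xc p m.a m.b (Nat.mul (part z) (Nat.pow xc m.c)) 0
          (Nat.add a (Nat.mul (Nat.add b (Nat.mul c (Nat.pow xb kb))) (Nat.pow xa ka))))
        (Bool.rec (motive := fun _ => ℕ)
          (ev3 part xa xb xc p ka m.b (Nat.mul (part z) (Nat.pow xc m.c)) (Nat.add b (Nat.mul c (Nat.pow xb kb))) a)
          (ev3 part xa xb xc p ka kb (Nat.add c (Nat.mul (part z) (Nat.pow xc m.c))) b a)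
          (Nat.beq m.b kb))
        (Nat.beq m.a ka) = _
    cases hka : Nat.beq m.a ka with
    | false =>
      show ev3 part xa xb xc p m.a m.b (Nat.mul (part z) (Nat.pow xc m.c)) 0
          (Nat.add a (Nat.mul (Nat.add b (Nat.mul c (Nat.pow xb kb))) (Nat.pow xa ka))) = _
      rw [ev3_eq part xa xb xc p]
      simp only [Nat.add_eq, Nat.mul_eq, Nat.pow_eq]; ring
    | true =>
      have ha : m.a = ka := Nat.eq_of_beq_eq_true hka
      cases hkb : Nat.beq m.b kb with
      | false =>
        show ev3 part xa xb xc p ka m.b (Nat.mul (part z) (Nat.pow xc m.c))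
            (Nat.add b (Nat.mul c (Nat.pow xb kb))) a = _
        rw [ev3_eq part xa xb xc p, ← ha]
        simp only [Nat.add_eq, Nat.mul_eq, Nat.pow_eq]; ring
      | true =>
        have hb : m.b = kb := Nat.eq_of_beq_eq_true hkb
        show ev3 part xa xb xc p ka kb (Nat.add c (Nat.mul (part z) (Nat.pow xc m.c))) b a = _
        rw [ev3_eq part xa xb xc p, ← ha, ← hb]
        simp only [Nat.add_eq, Nat.mul_eq, Nat.pow_eq]; ring

/-- The two sign parts give the integer value. -/
theorem partSum_sub (xa xb xc : ℕ) : ∀ p : SPoly,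
    ((partSum zpos xa xb xc p : ℕ) : ℤ) - (partSum zneg xa xb xc p : ℕ) = evalZ p xa xb xc
  | [] => by simp [partSum]
  | (m, z) :: p => by
    have ih := partSum_sub xa xb xc p
    have hP : partSum zpos xa xb xc ((m, z) :: p) = zpos z * (xa ^ m.a * xb ^ m.b * xc ^ m.c) + partSum zpos xa xb xc p := by
      simp [partSum]
    have hN : partSum zneg xa xb xc ((m, z) :: p) = zneg z * (xa ^ m.a * xb ^ m.b * xc ^ m.c) + partSum zneg xa xb xc p := by
      simp [partSum]
    rw [hP, hN, evalZ_cons, ← ih]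
    have hz := zpos_sub_zneg z
    simp only [monoEvalZ]
    push_cast
    linear_combination ((xa : ℤ) ^ m.a * (xb : ℤ) ^ m.b * (xc : ℤ) ^ m.c) * hz

/-- `evP − evN` is the value at the point. -/
theorem ev_sub (xa xb xc : ℕ) (p : SPoly) :
    ((evP xa xb xc p : ℕ) : ℤ) - (evN xa xb xc p : ℕ) = evalZ p xa xb xc := by
  unfold evP evN
  rw [ev3_eq, ev3_eq, ← partSum_sub]
  simp

/-- `withEv` is application to the two parts. -/
theorem withEv_eq {α : Type} (xa xb xc : ℕ) (p : SPoly) (k : ℕ → ℕ → α) :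
    withEv xa xb xc p k = k (evP xa xb xc p) (evN xa xb xc p) := by
  unfold withEv; rw [forceNat_eq, forceNat_eq]

/-- The parts give the value of a product. -/
theorem mulPP_sub_mulPN (pP pN qP qN : ℕ) :
    ((mulPP pP pN qP qN : ℕ) : ℤ) - (mulPN pP pN qP qN : ℕ) = ((pP : ℤ) - pN) * ((qP : ℤ) - qN) := by
  unfold mulPP mulPN
  simp only [Nat.add_eq, Nat.mul_eq]
  push_cast; ring

/-! ### Meaning of the flat programs -/

/-- `znat` is `Int.toNat`. -/
theorem znat_eq (z : ℤ) : znat z = z.toNat := by cases z <;> rfl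

/-- `polyOfChunks` of a cons. -/
theorem polyOfChunks_cons (l : List ℤ) (ls : List (List ℤ)) :
    polyOfChunks (l :: ls) = ofFlat l ++ polyOfChunks ls := rfl

/-- `partSum` is additive over `++`. -/
theorem partSum_append (part : ℤ → ℕ) (xa xb xc : ℕ) (p q : SPoly) :
    partSum part xa xb xc (p ++ q) = partSum part xa xb xc p + partSum part xa xb xc q := by
  simp [partSum, List.map_append, List.sum_append]

/-- The state of the grouped evaluation: run key `(ka, kb)` and accumulators `c, b, a`. -/
structure St3 where
  /-- `a`-exponent of the current run -/
  ka : ℕ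
  /-- `b`-exponent of the current run -/
  kb : ℕ
  /-- run accumulator -/
  c : ℕ
  /-- `a`-block accumulator -/
  b : ℕ
  /-- total -/
  a : ℕ

/-- The quantity carried by a state: `a + x_a^ka · (b + x_b^kb · c)`. -/
def St3.inv (xa xb : ℕ) (s : St3) : ℕ := s.a + xa ^ s.ka * (s.b + xb ^ s.kb * s.c)

/-- The grouped update by one term, on states. -/
def step3 (part : ℤ → ℕ) (xa xb xc : ℕ) (m : Mono) (z : ℤ) (s : St3) : St3 :=
  bif Nat.beq m.a s.ka then
    (bif Nat.beq m.b s.kb then ⟨s.ka, s.kb, s.c + part z * xc ^ m.c, s.b, s.a⟩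
     else ⟨s.ka, m.b, part z * xc ^ m.c, s.b + s.c * xb ^ s.kb, s.a⟩)
  else ⟨m.a, m.b, part z * xc ^ m.c, 0, s.a + (s.b + s.c * xb ^ s.kb) * xa ^ s.ka⟩

/-- The grouped updates by a term list. -/
def run3 (part : ℤ → ℕ) (xa xb xc : ℕ) (p : SPoly) (s : St3) : St3 :=
  p.foldl (fun s mc => step3 part xa xb xc mc.1 mc.2 s) s

/-- One update adds the term to the carried quantity. -/
theorem inv_step3 (part : ℤ → ℕ) (xa xb xc : ℕ) (m : Mono) (z : ℤ) (s : St3) :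
    (step3 part xa xb xc m z s).inv xa xb = s.inv xa xb + part z * (xa ^ m.a * xb ^ m.b * xc ^ m.c) := by
  unfold step3 St3.inv
  cases ha : Nat.beq m.a s.ka with
  | false => simp only [cond_false]; ring
  | true =>
    have ea : m.a = s.ka := Nat.eq_of_beq_eq_true ha
    cases hb : Nat.beq m.b s.kb with
    | false => simp only [cond_true, cond_false]; rw [ea]; ring
    | true =>
      have eb : m.b = s.kb := Nat.eq_of_beq_eq_true hb
      simp only [cond_true]; rw [ea, eb]; ring

/-- A run adds the part sum to the carried quantity. -/
theorem inv_run3 (part : ℤ → ℕ) (xa xb xc : ℕ) : ∀ (p : SPoly) (s : St3),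
    (run3 part xa xb xc p s).inv xa xb = s.inv xa xb + partSum part xa xb xc p
  | [], s => by simp [run3, partSum]
  | (m, z) :: p, s => by
    have e : run3 part xa xb xc ((m, z) :: p) s = run3 part xa xb xc p (step3 part xa xb xc m z s) := by
      simp [run3, List.foldl_cons]
    rw [e, inv_run3 part xa xb xc p, inv_step3]
    simp [partSum]; ring

/-- **The chunk program computes `run3` on the decoded chunk** (by strong induction on the length:
four cells make one term; a trailing fragment of fewer than four cells is ignored, as in `ofFlat`). -/
theorem evF_spec (part : ℤ → ℕ) (xa xb xc : ℕ) (k : ℕ → ℕ → ℕ → ℕ → ℕ → ℕ) :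
    ∀ (n : ℕ) (l : List ℤ), l.length ≤ n → ∀ ka kb c b a : ℕ,
      evF part xa xb xc l 0 0 0 0 ka kb c b a k =
        (fun s : St3 => k s.ka s.kb s.c s.b s.a) (run3 part xa xb xc (ofFlat l) ⟨ka, kb, c, b, a⟩)
  | n, [], _, ka, kb, c, b, a => by simp only [run3, ofFlat, List.foldl_nil]; rfl
  | n, [x], _, ka, kb, c, b, a => by simp only [run3, ofFlat, List.foldl_nil]; rfl
  | n, [x, y], _, ka, kb, c, b, a => by simp only [run3, ofFlat, List.foldl_nil]; rfl
  | n, [x, y, v], _, ka, kb, c, b, a => by simp only [run3, ofFlat, List.foldl_nil]; rfl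
  | 0, x :: y :: v :: z :: rest, hn, ka, kb, c, b, a => by simp at hn
  | n + 1, x :: y :: v :: z :: rest, hn, ka, kb, c, b, a => by
    have hrest : rest.length ≤ n := by simp only [List.length_cons] at hn; omega
    have ih := evF_spec part xa xb xc k n rest hrest
    show Bool.rec (motive := fun _ => ℕ)
        (evF part xa xb xc rest 0 0 0 0 (znat x) (znat y) (Nat.mul (part z) (Nat.pow xc (znat v))) 0
          (Nat.add a (Nat.mul (Nat.add b (Nat.mul c (Nat.pow xb kb))) (Nat.pow xa ka))) k)
        (Bool.rec (motive := fun _ => ℕ)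
          (evF part xa xb xc rest 0 0 0 0 ka (znat y) (Nat.mul (part z) (Nat.pow xc (znat v)))
            (Nat.add b (Nat.mul c (Nat.pow xb kb))) a k)
          (evF part xa xb xc rest 0 0 0 0 ka kb (Nat.add c (Nat.mul (part z) (Nat.pow xc (znat v)))) b a k)
          (Nat.beq (znat y) kb))
        (Nat.beq (znat x) ka) = _
    rw [ofFlat, run3, List.foldl_cons, ← run3]
    simp only [znat_eq, Nat.add_eq, Nat.mul_eq, Nat.pow_eq]
    unfold step3
    simp only []
    cases h1 : Nat.beq x.toNat ka with
    | false => simp only [cond_false]; exact ih _ _ _ _ _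
    | true =>
      cases h2 : Nat.beq y.toNat kb with
      | false => simp only [cond_true, cond_false]; exact ih _ _ _ _ _
      | true => simp only [cond_true]; exact ih _ _ _ _ _

/-- States after a list of chunks. -/
def runs3 (part : ℤ → ℕ) (xa xb xc : ℕ) (ls : List (List ℤ)) (s : St3) : St3 :=
  ls.foldl (fun s l => run3 part xa xb xc (ofFlat l) s) s

/-- The chunk-list program computes the carried quantity of the final state. -/
theorem evFs_spec (part : ℤ → ℕ) (xa xb xc : ℕ) : ∀ (ls : List (List ℤ)) (s : St3),
    evFs part xa xb xc ls s.ka s.kb s.c s.b s.a = (runs3 part xa xb xc ls s).inv xa xb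
  | [], s => by
    show Nat.add s.a (Nat.mul (Nat.add s.b (Nat.mul s.c (Nat.pow xb s.kb))) (Nat.pow xa s.ka)) = _
    simp only [runs3, List.foldl_nil, St3.inv, Nat.add_eq, Nat.mul_eq, Nat.pow_eq]; ring
  | l :: ls, s => by
    show evF part xa xb xc l 0 0 0 0 s.ka s.kb s.c s.b s.a (evFs part xa xb xc ls) = _
    rw [evF_spec part xa xb xc (evFs part xa xb xc ls) l.length l le_rfl]
    show evFs part xa xb xc ls _ _ _ _ _ = _
    rw [evFs_spec part xa xb xc ls (run3 part xa xb xc (ofFlat l) ⟨s.ka, s.kb, s.c, s.b, s.a⟩)]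
    rfl

/-- The chunks add their part sums. -/
theorem inv_runs3 (part : ℤ → ℕ) (xa xb xc : ℕ) : ∀ (ls : List (List ℤ)) (s : St3),
    (runs3 part xa xb xc ls s).inv xa xb = s.inv xa xb + partSum part xa xb xc (polyOfChunks ls)
  | [], s => by simp [runs3, polyOfChunks, partSum]
  | l :: ls, s => by
    have e : runs3 part xa xb xc (l :: ls) s = runs3 part xa xb xc ls (run3 part xa xb xc (ofFlat l) s) := by
      simp [runs3, List.foldl_cons]
    rw [e, inv_runs3 part xa xb xc ls, inv_run3, polyOfChunks_cons, partSum_append]; ring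

/-- One sign part of the value of `polyOfChunks ls`. -/
theorem evFs_zero (part : ℤ → ℕ) (xa xb xc : ℕ) (ls : List (List ℤ)) :
    evFs part xa xb xc ls 0 0 0 0 0 = partSum part xa xb xc (polyOfChunks ls) := by
  have h := evFs_spec part xa xb xc ls ⟨0, 0, 0, 0, 0⟩
  simp only [] at h
  rw [h, inv_runs3]
  simp [St3.inv]

/-- **`evFP − evFN` is the value of the encoded term list at the point.** -/
theorem evF_sub (xa xb xc : ℕ) (ls : List (List ℤ)) :
    ((evFP xa xb xc ls : ℕ) : ℤ) - (evFN xa xb xc ls : ℕ) = evalZ (polyOfChunks ls) xa xb xc := by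
  unfold evFP evFN
  rw [evFs_zero, evFs_zero, partSum_sub]

/-- `withEvF` is application to the two parts. -/
theorem withEvF_eq {α : Type} (xa xb xc : ℕ) (ls : List (List ℤ)) (k : ℕ → ℕ → α) :
    withEvF xa xb xc ls k = k (evFP xa xb xc ls) (evFN xa xb xc ls) := by
  unfold withEvF; rw [forceNat_eq, forceNat_eq]

/-- Scaled parts give the value of a scalar multiple. -/
theorem smul_parts (s P N : ℕ) (v : ℤ) (h : (P : ℤ) - N = v) :
    ((s * P : ℕ) : ℤ) - (s * N : ℕ) = (s : ℤ) * v := by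
  rw [← h]; push_cast; ring

/-- The flat value check at `τ` gives `qII = 0` at `(2^w, 2^{wD}, τ)`. -/
theorem evalZ_qII_of_idIIAtF (w D τ : ℕ) (c : Cert3) (P : CertPolys3) (ρ : SPoly)
    (FPc E0c E1c E2c E3c E4c ρc : List (List ℤ)) (s0 s1 s2 s3 s4 : ℕ)
    (eFP : P.FP = polyOfChunks FPc) (e0 : P.E0 = smul (s0 : ℤ) (polyOfChunks E0c))
    (e1 : P.E1 = smul (s1 : ℤ) (polyOfChunks E1c)) (e2 : P.E2 = smul (s2 : ℤ) (polyOfChunks E2c))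
    (e3 : P.E3 = smul (s3 : ℤ) (polyOfChunks E3c)) (e4 : P.E4 = smul (s4 : ℤ) (polyOfChunks E4c))
    (eρ : ρ = polyOfChunks ρc)
    (h : idIIAtF w D τ c FPc E0c E1c E2c E3c E4c ρc s0 s1 s2 s3 s4 = true) :
    evalZ (qII c P ρ) (2 ^ w) (2 ^ (w * D)) (τ : ℤ) = 0 := by
  unfold idIIAtF at h
  simp only [withEvF_eq, withEv_eq, Nat.beq_eq, Nat.add_eq, Nat.mul_eq, Nat.pow_eq] at h
  have hZ := congrArg (fun n : ℕ => (n : ℤ)) h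
  simp only [Nat.cast_add] at hZ
  have hX : (((2 : ℕ) ^ w : ℕ) : ℤ) = 2 ^ w := by push_cast; rfl
  have hY : (((2 : ℕ) ^ (w * D) : ℕ) : ℤ) = 2 ^ (w * D) := by push_cast; rfl
  simp only [qII, targetII3, rhsG, evalZ_append, evalZ_neg, evalZ_mul, evalZ_permBAC, evalZ_permCBA,
    evalZ_C]
  rw [eFP, e0, e1, e2, e3, e4, eρ]
  simp only [evalZ_smul]
  rw [← hX, ← hY]
  have g := fun (xa xb xc : ℕ) (p : SPoly) => ev_sub xa xb xc p
  have f := fun (xa xb xc : ℕ) (ls : List (List ℤ)) => evF_sub xa xb xc ls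
  rw [← f _ _ _ FPc, ← f _ _ _ ρc,
    ← g (2 ^ w) _ _ (gqU c.p c.q), ← g (2 ^ (w * D)) (2 ^ w) _ (gqU c.p c.q), ← g τ _ _ (gqU c.p c.q),
    ← g _ _ _ (m2G c.p c.q), ← g _ _ _ (m3G c.p c.q), ← g _ _ _ p4]
  have a0 := smul_parts s0 _ _ _ (f (2 ^ w) (2 ^ (w * D)) τ E0c)
  have a1 := smul_parts s1 _ _ _ (f (2 ^ w) (2 ^ (w * D)) τ E1c)
  have b1 := smul_parts s1 _ _ _ (f (2 ^ (w * D)) (2 ^ w) τ E1c)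
  have c1 := smul_parts s1 _ _ _ (f τ (2 ^ (w * D)) (2 ^ w) E1c)
  have a2 := smul_parts s2 _ _ _ (f (2 ^ w) (2 ^ (w * D)) τ E2c)
  have a3 := smul_parts s3 _ _ _ (f (2 ^ w) (2 ^ (w * D)) τ E3c)
  have a4 := smul_parts s4 _ _ _ (f (2 ^ w) (2 ^ (w * D)) τ E4c)
  rw [← a0, ← a1, ← b1, ← c1, ← a2, ← a3, ← a4]
  have h1 := mulPP_sub_mulPN (evP (2 ^ w) (2 ^ (w * D)) τ (gqU c.p c.q)) (evN (2 ^ w) (2 ^ (w * D)) τ (gqU c.p c.q))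
    (s1 * evFP (2 ^ w) (2 ^ (w * D)) τ E1c) (s1 * evFN (2 ^ w) (2 ^ (w * D)) τ E1c)
  have h2 := mulPP_sub_mulPN (evP (2 ^ (w * D)) (2 ^ w) τ (gqU c.p c.q)) (evN (2 ^ (w * D)) (2 ^ w) τ (gqU c.p c.q))
    (s1 * evFP (2 ^ (w * D)) (2 ^ w) τ E1c) (s1 * evFN (2 ^ (w * D)) (2 ^ w) τ E1c)
  have h3 := mulPP_sub_mulPN (evP τ (2 ^ (w * D)) (2 ^ w) (gqU c.p c.q)) (evN τ (2 ^ (w * D)) (2 ^ w) (gqU c.p c.q))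
    (s1 * evFP τ (2 ^ (w * D)) (2 ^ w) E1c) (s1 * evFN τ (2 ^ (w * D)) (2 ^ w) E1c)
  have h4 := mulPP_sub_mulPN (evP (2 ^ w) (2 ^ (w * D)) τ (m2G c.p c.q)) (evN (2 ^ w) (2 ^ (w * D)) τ (m2G c.p c.q))
    (s2 * evFP (2 ^ w) (2 ^ (w * D)) τ E2c) (s2 * evFN (2 ^ w) (2 ^ (w * D)) τ E2c)
  have h5 := mulPP_sub_mulPN (evP (2 ^ w) (2 ^ (w * D)) τ (m3G c.p c.q)) (evN (2 ^ w) (2 ^ (w * D)) τ (m3G c.p c.q))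
    (s3 * evFP (2 ^ w) (2 ^ (w * D)) τ E3c) (s3 * evFN (2 ^ w) (2 ^ (w * D)) τ E3c)
  have h6 := mulPP_sub_mulPN (evP (2 ^ w) (2 ^ (w * D)) τ p4) (evN (2 ^ w) (2 ^ (w * D)) τ p4)
    (s4 * evFP (2 ^ w) (2 ^ (w * D)) τ E4c) (s4 * evFN (2 ^ w) (2 ^ (w * D)) τ E4c)
  linear_combination -hZ + h1 + h2 + h3 + h4 + h5 + h6

/-- The static check from per-polynomial facts (each a separate small kernel computation in a row
file: exponent boxes by `decide`, coefficient sums as numerals) and the two width bounds on numerals. -/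
theorem idIIStatic_of (w wm D : ℕ) (c : Cert3) (P : CertPolys3) (ρ : SPoly)
    (hD : 2 ≤ D) (hFP : boxOK D P.FP = true) (h0 : boxOK D P.E0 = true) (h1 : boxOK (D - 2) P.E1 = true)
    (h2 : boxOK (D - 2) P.E2 = true) (h3 : boxOK (D - 2) P.E3 = true) (h4 : boxOK (D - 2) P.E4 = true)
    (hρ : boxOK D ρ = true) (hab : absSum ρ ≤ c.c0) (nF n0 n1 n2 n3 n4 nρ : ℕ)
    (eF : absSum P.FP = nF) (a0 : absSum P.E0 = n0) (a1 : absSum P.E1 = n1) (a2 : absSum P.E2 = n2)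
    (a3 : absSum P.E3 = n3) (a4 : absSum P.E4 = n4) (aρ : absSum ρ = nρ)
    (hw : 2 * (c.B22 + nF + (n0 + 3 * (absSum (gqU c.p c.q) * n1) + absSum (m2G c.p c.q) * n2 +
      absSum (m3G c.p c.q) * n3 + absSum p4 * n4) + c.c0 + nρ) < 2 ^ w)
    (hwm : 2 * ((c.B22 + nF + (n0 + 3 * (absSum (gqU c.p c.q) * n1) + absSum (m2G c.p c.q) * n2 +
      absSum (m3G c.p c.q) * n3 + absSum p4 * n4) + c.c0 + nρ) * D ^ D) < 2 ^ wm) :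
    idIIStatic w wm D c P ρ = true := by
  subst eF a0 a1 a2 a3 a4 aρ
  unfold idIIStatic bndII
  simp only [Bool.and_eq_true, decide_eq_true_eq]
  exact ⟨⟨⟨⟨⟨⟨⟨⟨⟨⟨hD, hFP⟩, h0⟩, h1⟩, h2⟩, h3⟩, h4⟩, hρ⟩, hab⟩, hw⟩, hwm⟩

/-- **Soundness of the multi-point identity check on flat data**: the static check, the chunk
equations of the row and the `D` flat value checks give the single-point boolean `idCheckII w D c P ρ`
(so `card_le_of_cert3KS` applies verbatim). -/
theorem idCheckII_of_pointsF (w wm D : ℕ) (c : Cert3) (P : CertPolys3) (ρ : SPoly)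
    (FPc E0c E1c E2c E3c E4c ρc : List (List ℤ)) (s0 s1 s2 s3 s4 : ℕ)
    (eFP : P.FP = polyOfChunks FPc) (e0 : P.E0 = smul (s0 : ℤ) (polyOfChunks E0c))
    (e1 : P.E1 = smul (s1 : ℤ) (polyOfChunks E1c)) (e2 : P.E2 = smul (s2 : ℤ) (polyOfChunks E2c))
    (e3 : P.E3 = smul (s3 : ℤ) (polyOfChunks E3c)) (e4 : P.E4 = smul (s4 : ℤ) (polyOfChunks E4c))
    (eρ : ρ = polyOfChunks ρc)
    (hs : idIIStatic w wm D c P ρ = true)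
    (hp : ∀ j : ℕ, j < D → idIIAtF wm D j c FPc E0c E1c E2c E3c E4c ρc s0 s1 s2 s3 s4 = true) :
    idCheckII w D c P ρ = true := by
  unfold idIIStatic at hs
  simp only [Bool.and_eq_true, decide_eq_true_eq] at hs
  obtain ⟨⟨⟨⟨⟨⟨⟨⟨⟨⟨hD, hFP⟩, h0⟩, h1⟩, h2⟩, h3⟩, h4⟩, hρ⟩, hab⟩, hw⟩, hwm⟩ := hs
  have hQ : ∀ u v t : ℝ, eval (qII c P ρ) u v t = 0 :=
    eval_eq_zero_of_kronecker_points wm D (qII c P ρ) (exps_qII D c P ρ hD hFP h0 h1 h2 h3 h4 hρ)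
      (by rw [absSum_qII]; exact hwm)
      (fun j hj => evalZ_qII_of_idIIAtF wm D j c P ρ FPc E0c E1c E2c E3c E4c ρc s0 s1 s2 s3 s4
        eFP e0 e1 e2 e3 e4 eρ (hp j hj))
  have hval : valII w (w * D) (w * D * D) c P ρ = 0 := by
    rw [valII_eq]
    have h := hQ ((2 ^ w : ℤ) : ℝ) ((2 ^ (w * D) : ℤ) : ℝ) ((2 ^ (w * D * D) : ℤ) : ℝ)
    rw [← cast_evalZ] at h
    exact_mod_cast h
  unfold idCheckII
  simp only [Bool.and_eq_true, decide_eq_true_eq]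
  exact ⟨⟨⟨⟨⟨⟨⟨⟨⟨⟨hD, hFP⟩, h0⟩, h1⟩, h2⟩, h3⟩, h4⟩, hρ⟩, hab⟩, hw⟩, hval⟩

end Summit.Ventures.PackingBounds.ThreePointCert

end
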